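import Literature.MathematicalPhysics.QuantumFieldTheory.Balaban1983to89.B8Prop6CubeMemberGauged

/-!
# `Balaban1983to89.B8Prop6CubeMemberOfPrinted` — [Balaban1985RegularSpaces] PROPOSITION 6 (p. 99), (1.135)–(1.138) AT EVERY CUBE,
# FROM THE PRINTED STATEMENTS OF THEOREM 4 (p. 88) AND PROPOSITION 3 (p. 87) AT PRINT'S CUBE FAMILY `{□_j}_{j=0}^{k}` — socket-free

statement-level skeleton of published theorems with citation tags; proofs where landed; nothing here is a claim about the
Yang–Mills mass gap

T. Bałaban, *Spaces of regular gauge field configurations on a lattice and gauge fixing conditions*, Commun. Math. Phys. **99**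
(1985) 75–102 `[Balaban1985RegularSpaces]` ("B8"), Sect. F pp. 98–99, Theorem 4 p. 88, Proposition 3 p. 87.  PDF held:
`paper:balaban1985-cmp99-regular-spaces-gauge-fixing` (journal page = PDF page + 74).

CITATION HEADER (lean-in-tree rule).  Cell `pub-ymgap` (YM Track A, HUMAN RULING D-0062), DAG node N05 = [B8], seat `pub-ymgap-dag-n05-e`
(R141 (C) fan-out; FAN-OUT v1.1 §N05 row s3b «Proposition 6 at a CONCRETE cube family»), generation g6.  WHY THIS FILE: every `p6` face of the
N05 knits so far is either «modulo the Theorem-4 sockets AT THE CUBE MEMBER» (`B8Prop6CubeMemberGauged.prop6Printed_zdCub₃`,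
`B8Prop6CubeMemberFlat3.prop6_exists_cubeMember_at₃`, `B8Prop6CubeMemberFlatScalar.prop6_cubeMember_flat_of_real`, …) — and those sockets are
UNSATISFIABLE at a finite `Ω₀` (this seat's g5 certificates `B8SockH59NotAtCube.not_sockH59_cubeMember`,
`B8JunctionH59Vacuity.not_sockB9P3_allLevels_cubeMember`), so the faces are vacuous as typed — or an undischarged printed hypothesis
`p6 : B8.Prop6Printed …` (`B8LeafKnitZd3OfThm4.b8LeafRS_zd3_univ_of_thm4`).  Print proves Proposition 6 from THE STATEMENTS of Theorem 4 and
Proposition 3 at the cube family: p. 99 *"If 7dL²Mα₀ ≤ c₁, then the assumptions of Theorem 4 are satisfied for the pair of configurations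
1, U₀″, thus there exists a gauge transformation u such that U₁ = U₀″^{u⁻¹} satisfies the conditions (1.36)–(1.39)"* — (1.37), (1.38), (1.62)
being Theorem 4's conclusions and (1.36), (1.39) Proposition 3's for the gauge-fixed field.  THIS MODULE types exactly that argument: its
two hypotheses are the tree's printed sentences `B8.Thm4Printed (5dLB₀)` (Theorem 4, p. 88) and `B8.Prop3Printed d L C₂ inp B₀β`
(Proposition 3, p. 87) read on n05-a's `ℤᵈ × 𝔸` carrier `B8LeafModelZd3.zdGF3`, EITHER on the cube sub-family of the index
`B8LeafModelZd.ZdIdx d L` (the members whose domains are a cube family `{□_j}_{j=0}^{k}` of (1.131) with print's truncations, in the regime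
`L ≤ ρ ≤ M`, `11d < M`, `L ≤ dM` of `Node00.CubeB8` — `B8CubeMemberZd.exists_member_cube`) OR on the whole index (the `H4` and `p3` slots of `b8LeafRS_zd3_univ_of_thm4`, verbatim).  No socket,
no (1.59) clause, no `def`.  Kind «kernel-checked proof», theorems only.

WHAT THIS MODULE PROVES (kernel, 0 sorry; `𝔸 : Type` a nontrivial C⋆-algebra, gauge group its unitary group; `a`∕`M` = lower corner∕side of
`□^{(k)}`, `ρ = R₁M₁`, as in `B8Eq131Cubes`; `B = 5dL·inp.B₀`).
§1 **`gaugedBoundB8_cubeMember_of_printed`** — ONE threshold `c₁(d, L, inp.B₀, C₂; the two printed thresholds) > 0` such that for every cube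
   `c : Node00.CubeB8 d L K Ω`, every unitary `U₀ ∈ 𝔄_K({Ω_j}, α₀)` and «`7dL²·c.M·α₀ ≤ c₁`»: `Node00.GaugedBoundB8 L η U₀ c (7dL²·B·c.M·α₀)` —
   GIVEN Theorem 4 and Proposition 3 as printed on the cube sub-family.  PROOF = print's paragraph: the datum `(1, U₀″)` satisfies Theorem 4's
   hypotheses at the member `{□_j}` with `(α₀, α₁) ↦ (L³α₀, 6dL²Mα₀)` (n05-c's `B8Prop6CubeMember.thm4_hypotheses_one_cutFixed`, (1.132)–(1.133));
   Theorem 4 gives `u` with (1.29), (1.37), (1.38), (1.62); Proposition 3 at `(L³α₀, 6dL²Mα₀, α₂ := B·(L³α₀ + 6dL²Mα₀))` for the gauge-fixed field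
   gives (1.36)'s gradient member and (1.39) (the pattern of n05-a's `B8LeafKnitZd3OfThm4.thm2Printed_zd3_univ_of_thm4`); this seat's g0 engine
   `B8Prop6CubeMemberGauged.gaugedBoundB8_of_clauses` assembles (1.135)–(1.138) (with (1.137)'s identity and (1.135) by `agree135`); every
   smallness window from «7dL²Mα₀ ≤ c₁» by `B8Prop6CubeMemberNormsAt.windows136_of_small`, the constant by `B8Prop6OfThm4.const_136`.
§2 **`prop6Printed_zdCub_of_printed`** — `B8.Prop6Printed d L B c₁ (fun j => Node00.zdCub 𝔸 L (f j))` for every `f : ι → ZdIdx d L`, from the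
   same two hypotheses; `prop6Printed_cubB8OfRecord_of_printed` — the sentence on NODE 00's member of record `Node00.cubB8OfRecord θ`.
§3 **`gaugedBoundB8_cubeMember_of_printedAll`**, **`prop6Printed_zdCub_of_printedAll`**, **`prop6Printed_cubB8OfRecord_of_printedAll`** — the
   same with Theorem 4 and Proposition 3 hypothesised on the WHOLE index `ZdIdx d L`, i.e. with EXACTLY the binders
   `H4 : B8.Thm4Printed (5dL·inp.B₀) (fun i : ZdIdx d L => (zdGF3 𝔸 L β len i).toGFData)` and
   `p3 : B8.Prop3Printed d L C₂ inp B₀β (fun i : ZdIdx d L => (zdGF3 𝔸 L β len i).toGFData2)` that n05-a's H4-currency knit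
   `B8LeafKnitZd3OfThm4.b8LeafRS_zd3_univ_of_thm4` already carries — so in that currency the knit's `p6` binder is a CONSEQUENCE of its `H4` and
   `p3` binders (restriction of the family index, pure logic).

HONEST SCOPE.  (i) By-name composition of landed theorems; nothing of Theorem 4 ∕ Proposition 3 ∕ (1.59) is proved here.  (ii) The two
hypotheses are PRINTED STATEMENTS — Theorem 4 (p. 88) and Proposition 3 (p. 87) for the admissible family `{□_j}_{j=0}^{k}` of p. 98–99
(`Ω₀ = □₀` finite; p. 77 «we admit the case where some domains Ω_j are equal to T_η» — finite `Ω₀` is print's general case) — NOT the tree's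
sockets; their hypotheses are met by the datum `(1, U₀″)` (non-vacuity of the implication: `thm4_hypotheses_one_cutFixed`); their discharge at
finite `Ω₀` is exactly the located socket question of this seat's g5 (`CORNER-DEFECT-H59.md`: the (1.59) clause needs the exterior-collar term at
finite `Ω₀`) and is NOT claimed.  (iii) As in `B8Prop6CubeMemberGauged`: not folded into `GaugedBoundB8` are the uniqueness of `u`, (1.137)'s
inequalities (`ineq137_cubeB8`, socket-free, landed) and the Hölder member; `≤` for print's `<`; `ℤᵈ` carriers.  Count-neutral; N05 NOT discharged;
one finite `𝕋⁴` programme at fixed `ε`, Bałaban as printed; nothing continuum ∕ ℝ⁴ ∕ OS ∕ mass-gap ∕ Clay.  Unit `pub-ymgap-dag-n05-e` (g6),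
2026-08-27.
-/

noncomputable section

open NormedSpace

namespace Literature.MathematicalPhysics.QuantumFieldTheory.Balaban1983to89.B8Prop6CubeMemberOfPrinted

open MatrixLog B7Prop1Explicit B7Prop2Explicit B7Prop1Local B7Eq92Concrete
open B7Prop3Flat (c3)
open B8Ineq132 (InAk inAk_gaugeAct_iff pdevOn_lt_of_inAk)
open B8Ineq133 (cutFixed)
open B8Eq115GaugeFixing (localGauge gaugeAct_mem_of)
open B8Eq119TwistedAxial (Restr129 InAx)
open B8Eq140Level (SideTouches)
open B8Eq184Proof (cfgExp)
open B8Eq138LandauZd (IsLandau138W logCfg)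
open B8Eq131Cubes (tcube tLo tHi ctr tLo_le_tHi)
open B8Eq131CubesAdmissible (cubeFam)
open B8CubeMemberZd (cubeLamS cubeLamB hΩ_cubeFam hbox_cubeLamB hclass_cubeLamB htower_cubeLam hpart_cubeLam)
open B8Prop6CubeMember (thm4_hypotheses_one_cutFixed)
open B8Prop6OfThm4 (const_136 smallness_134 localGauge_mem agree135)
open B8LeafModelZd (ZdIdx)
open B8LeafModelZd3 (mlogCfg zdGF3)
open B8Prop6CubeMemberNormsAt (windows136_of_small)
open B8Prop6CubeMemberGauged (gaugedBoundB8_of_clauses)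
open B8Prop3GaugeFixedKLevel (mem_unitaryUnits_of_mgauge_eq)
open B8Thm4AtLandau138 (mgauge_mgauge_inv)
open Node00 (CubeB8 GaugedBoundB8 zdCub prop6Printed_zdCub_iff)

-- `Site` alone could resolve to the torus sites of `Setup.lean`; re-export the `ℤ^d` sites of `B7Prop1Explicit`.
export B7Prop1Explicit (Site)

variable {d : ℕ}

variable {𝔸 : Type} [CStarAlgebra 𝔸] [Nontrivial 𝔸]

/-! ## §1 (1.135)–(1.138) at every cube from Theorem 4 and Proposition 3 AS PRINTED on the cube sub-family -/

/-- **PROPOSITION 6 (p. 99), (1.135)–(1.138) AS `Node00.GaugedBoundB8` AT EVERY CUBE, FROM THEOREM 4 (p. 88) AND PROPOSITION 3 (p. 87) AS PRINTED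
ON PRINT'S CUBE FAMILIES** — «If 7dL²Mα₀ ≤ c₁, then the assumptions of Theorem 4 are satisfied for the pair of configurations 1, U₀″, thus there
exists a gauge transformation u such that U₁ = U₀″^{u⁻¹} satisfies the conditions (1.36)–(1.39) … **Proposition 6.** Let U₀, U₀′, □, □̃ be as
described above, and let 7dL²Mα₀ ≤ c₁.  There exists a gauge transformation u defined on □̃ and such, that U₀^{u⁻¹} = U₁ = e^{iηA} on □̃, (1.135)
Lʲη|A|, (Lʲη)²|∇^ηA|, (Lʲη)³|∂^{η*}∂^ηA|, (Lʲη)³|Δ^ηA| < 7dL²B₁Mα₀ on □_j, (1.136) … R∂^{η*}A = 0 (1.138)».  HYPOTHESES: the printed sentences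
`B8.Thm4Printed (5dL·inp.B₀)` and `B8.Prop3Printed d L C₂ inp B₀β` on n05-a's carrier `zdGF3` over the CUBE SUB-FAMILY of `ZdIdx d L` (members
whose domains are a cube family `{□_j}_{j=0}^{k}` of (1.131) with print's truncations in `CubeB8`'s regime `L ≤ ρ ≤ M`, `11d < M`, `L ≤ dM`;
`B8CubeMemberZd`).  CONCLUSION: ONE threshold `c₁ > 0`; for
every cube `c : CubeB8 d L K Ω`, unitary `U₀ ∈ 𝔄_K({Ω_j}, α₀)` and «`7dL²·c.M·α₀ ≤ c₁`»: `GaugedBoundB8 L η U₀ c (7dL²(5dL·inp.B₀)·c.M·α₀)`.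
Socket-free. [cite: Balaban1985RegularSpaces, Prop. 6 (1.135)–(1.138) p.99, p.99 (sentence after (1.133)), Thm 4 p.88, Prop. 3 p.87, (1.132)–(1.133) p.99] -/
theorem gaugedBoundB8_cubeMember_of_printed (hd2 : 2 ≤ d) {L : ℕ} (hL : 2 ≤ L) (inp : B8.B9Inputs) {B₀β C₂ : ℝ} (hC₂ : 0 ≤ C₂)
    (β : ℝ) (len : Site d → ℝ)
    (H4 : B8.Thm4Printed (5 * (d : ℝ) * L * inp.B₀)
      (fun i : {i : ZdIdx d L // ∃ (a : Site d) (M ρ : ℕ), L ≤ ρ ∧ ρ ≤ M ∧ 11 * d < M ∧ L ≤ d * M ∧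
        i.Ω = cubeFam false L a M ρ i.k ∧ i.Λs = cubeLamS L a M ρ i.k ∧
        i.Λb = cubeLamB L a M ρ i.k} => (zdGF3 𝔸 L β len i.1).toGFData))
    (H3 : B8.Prop3Printed d (L : ℝ) C₂ inp B₀β
      (fun i : {i : ZdIdx d L // ∃ (a : Site d) (M ρ : ℕ), L ≤ ρ ∧ ρ ≤ M ∧ 11 * d < M ∧ L ≤ d * M ∧
        i.Ω = cubeFam false L a M ρ i.k ∧ i.Λs = cubeLamS L a M ρ i.k ∧
        i.Λb = cubeLamB L a M ρ i.k} => (zdGF3 𝔸 L β len i.1).toGFData2)) :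
    ∃ c₁ : ℝ, 0 < c₁ ∧ ∀ (η : ℝ), 0 < η → ∀ {K : ℕ} {Ω : ℕ → Set (Site d)} (c : CubeB8 d L K Ω),
      ∀ (U₀ : Site d → Fin d → 𝔸ˣ), (∀ x κ, U₀ x κ ∈ unitaryUnits 𝔸) → ∀ (α₀ : ℝ), 0 < α₀ → InAk L K η α₀ Ω U₀ →
      7 * d * (L : ℝ) ^ 2 * c.M * α₀ ≤ c₁ →
      GaugedBoundB8 L η U₀ c (7 * d * (L : ℝ) ^ 2 * (5 * (d : ℝ) * L * inp.B₀) * c.M * α₀) := by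
  have hL1 : 1 ≤ L := le_trans (by norm_num) hL
  have hd1 : 1 ≤ d := le_trans (by norm_num) hd2
  have hLpos : (0 : ℝ) < L := by exact_mod_cast hL1
  have hdpos : (0 : ℝ) < d := by exact_mod_cast hd1
  have hB₀ : 0 < inp.B₀ := inp.B₀_pos
  obtain ⟨c₄, hc₄, T4⟩ := H4
  obtain ⟨c₃, hc₃, P3⟩ := H3
  obtain ⟨cW, hcW, W⟩ := windows136_of_small hd2 hL hB₀ hC₂ hc₃
  set B : ℝ := 5 * (d : ℝ) * L * inp.B₀ with hB_def
  have hB0 : 0 < B := by positivity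
  set C : ℝ := 131072 * ((d : ℝ) + 1) ^ 2 with hC_def
  have hC0 : 0 < C := by positivity
  refine ⟨min c₄ (min cW (1 / (16 * C * B))), lt_min hc₄ (lt_min hcW (by positivity)), ?_⟩
  intro η hη K Ω c U₀ hU₀ α₀ hα hAK hs
  -- the cube's laws as datum binders
  have hk : 1 ≤ c.k := c.one_le_k
  have hρL : L ≤ c.ρ := c.L_le_ρ
  have hρM : c.ρ ≤ c.M := c.ρ_le_M
  have hρ : 1 ≤ c.ρ := hL1.trans hρL
  have hM1 : 1 ≤ c.M := hρ.trans hρM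
  have hM : 11 * (d : ℝ) < c.M := by exact_mod_cast c.big
  have hLdM : (L : ℝ) ≤ d * c.M := by exact_mod_cast c.L_le_dM
  have hA : InAk L c.k η α₀ Ω U₀ := c.inAk hAK
  have hs₄ : 7 * d * (L : ℝ) ^ 2 * c.M * α₀ ≤ c₄ := hs.trans (min_le_left _ _)
  have hsW : 7 * d * (L : ℝ) ^ 2 * c.M * α₀ ≤ cW := hs.trans ((min_le_right _ _).trans (min_le_left _ _))
  have hsC : 7 * d * (L : ℝ) ^ 2 * c.M * α₀ ≤ 1 / (16 * C * B) := hs.trans ((min_le_right _ _).trans (min_le_right _ _))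
  -- every window from «7dL²Mα₀ ≤ c₁»
  obtain ⟨⟨hα3, hα2, hsmall⟩, ⟨hα₀c, hα₁c, hα₂c⟩, h61, ⟨-, -, h16, -, hc3α, -⟩, h12⟩ := W c.M c.ρ hM1 hρM hM hLdM α₀ hα hsW
  -- the shifted smallness pair `(α₀′, α₁′) = (L³α₀, 6dL²Mα₀)` and `t = α₀′ + α₁′`
  have hα₀' : 0 < (L : ℝ) ^ 3 * α₀ := by positivity
  have hMpos : (0 : ℝ) < c.M := by exact_mod_cast hM1
  have hα₁' : 0 < 6 * d * (L : ℝ) ^ 2 * c.M * α₀ := by positivity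
  have ht₄ : (L : ℝ) ^ 3 * α₀ + 6 * d * (L : ℝ) ^ 2 * c.M * α₀ ≤ c₄ := smallness_134 hLpos hα hLdM hs₄
  have htpos : 0 < (L : ℝ) ^ 3 * α₀ + 6 * d * (L : ℝ) ^ 2 * c.M * α₀ := add_pos hα₀' hα₁'
  have hα₂pos : 0 < B * ((L : ℝ) ^ 3 * α₀ + 6 * d * (L : ℝ) ^ 2 * c.M * α₀) := mul_pos hB0 htpos
  -- «the assumptions of Theorem 4 are satisfied for the pair 1, U₀″» (n05-c)
  obtain ⟨hmem, h33, h34, hAx, h135b, h66⟩ :=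
    thm4_hypotheses_one_cutFixed L hL hd1 c.k U₀ hU₀ hα hα3 hα2 c.a hρ hρM hM hη hA c.tcube_sub hsmall
  set U'' := cutFixed L (tLo c.a c.ρ) (tHi c.a c.M c.ρ) U₀ c.k (ctr c.a c.M) with hU''
  have hone : ∀ x κ, (1 : Site d → Fin d → 𝔸ˣ) x κ ∈ unitaryUnits 𝔸 := fun _ _ => (unitaryUnits 𝔸).one_mem
  -- the member `{□_j}` of the cube sub-family
  set ic : ZdIdx d L := ⟨η, hη, c.k, hk, cubeFam false L c.a c.M c.ρ c.k, hΩ_cubeFam hL1 c.a c.M hρL c.k, cubeLamS L c.a c.M c.ρ c.k,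
    cubeLamB L c.a c.M c.ρ c.k, hbox_cubeLamB L c.a c.M c.ρ c.k, hclass_cubeLamB L c.a c.M c.ρ c.k, htower_cubeLam hL1 c.a c.M c.ρ c.k,
    hpart_cubeLam hL1 c.a c.M c.ρ c.k⟩ with hic_def
  have hic : ∃ (a : Site d) (M ρ : ℕ), L ≤ ρ ∧ ρ ≤ M ∧ 11 * d < M ∧ L ≤ d * M ∧
      ic.Ω = cubeFam false L a M ρ ic.k ∧ ic.Λs = cubeLamS L a M ρ ic.k ∧ ic.Λb = cubeLamB L a M ρ ic.k :=
    ⟨c.a, c.M, c.ρ, hρL, hρM, c.big, c.L_le_dM, rfl, rfl, rfl⟩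
  -- THEOREM 4 at the member, for the datum `(1, U₀″)` at `(α₀′, α₁′)`
  obtain ⟨u, hR, ⟨h137, hLan, h162⟩, -⟩ :=
    T4 ⟨ic, hic⟩ ((L : ℝ) ^ 3 * α₀) (6 * d * (L : ℝ) ^ 2 * c.M * α₀) hα₀' hα₁' ht₄ ⟨1, hone⟩ (⟨1, hone⟩, ⟨U'', hmem⟩) h33 trivial
      ⟨rfl, h34, hAx⟩ ⟨h135b, h66⟩
  have hu : ∀ x, u.1 x ∈ unitaryUnits 𝔸 := u.2.1
  have huS : ∀ x, x ∉ cubeFam false L c.a c.M c.ρ c.k 0 → u.1 x = 1 := u.2.2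
  have h129 : Restr129 L c.k (cubeLamS L c.a c.M c.ρ c.k c.k) (1 : Site d → Fin d → 𝔸ˣ) u.1 := hR
  -- the gauge-fixed field `U₁ = U₀″^{u⁻¹}` (at background `1` the moving-frame action is the ordinary gauge action)
  have hW : mgauge (1 : Site d → Fin d → 𝔸ˣ) u.1 (mgauge (1 : Site d → Fin d → 𝔸ˣ) u.1⁻¹ U'') = U'' := mgauge_mgauge_inv _ U'' u.1
  have hWu : ∀ x κ, mgauge (1 : Site d → Fin d → 𝔸ˣ) u.1⁻¹ U'' x κ ∈ unitaryUnits 𝔸 := mem_unitaryUnits_of_mgauge_eq hone hmem hu hW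
  have hLan' : IsLandau138W L c.k η (cubeFam false L c.a c.M c.ρ c.k 0) (cubeLamS L c.a c.M c.ρ c.k c.k) (1 : Site d → Fin d → 𝔸ˣ)
      (gaugeAct u.1⁻¹ U'') := by
    have h := hLan
    simp only [zdGF3, mgauge_one_left] at h
    exact h
  have h162' : ∀ j, j ≤ c.k → ∀ b ∈ {b : Site d × Fin d | SideTouches (cubeFam false L c.a c.M c.ρ c.k j) b.1 b.2},
      gaugeAct u.1⁻¹ U'' b.1 b.2 = cfgExp η (logCfg η (gaugeAct u.1⁻¹ U'')) b.1 b.2 ∧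
        IsSelfAdjoint (logCfg η (gaugeAct u.1⁻¹ U'') b.1 b.2) ∧
        ‖logCfg η (gaugeAct u.1⁻¹ U'') b.1 b.2‖ ≤
          (5 * (d : ℝ) * L * inp.B₀ * ((L : ℝ) ^ 3 * α₀ + 6 * d * (L : ℝ) ^ 2 * c.M * α₀)) * ((L : ℝ) ^ j * η)⁻¹ := by
    have h := h162
    simp only [zdGF3, mgauge_one_left] at h
    exact h
  -- PROPOSITION 3 at the member, at `(α₀′, α₁′, α₂ := B·t)`, for the gauge-fixed field
  have hPair : (zdGF3 𝔸 L β len ic).InAPair ((L : ℝ) ^ 3 * α₀) ⟨1, hone⟩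
      ((zdGF3 𝔸 L β len ic).act (⟨1, hone⟩, ⟨U'', hmem⟩) u) := by
    show InAk L c.k η ((L : ℝ) ^ 3 * α₀) (cubeFam false L c.a c.M c.ρ c.k)
      (B8Lemma1NonAbelian.mulCfg (mgauge (1 : Site d → Fin d → 𝔸ˣ) u.1⁻¹ U'') (1 : Site d → Fin d → 𝔸ˣ))
    have hui : ∀ x, u.1⁻¹ x ∈ U1 𝔸 := fun x => unitaryUnits_le_U1 ((unitaryUnits 𝔸).inv_mem (hu x))
    rw [B8Prop3GaugeFixedKLevel.mulCfg_eq_gaugeAct_of_mgauge_eq hW]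
    exact (inAk_gaugeAct_iff L c.k η _ _ hui _).2 h34
  have h162'' : (zdGF3 𝔸 L β len ic).C162 1 (B * ((L : ℝ) ^ 3 * α₀ + 6 * d * (L : ℝ) ^ 2 * c.M * α₀)) ⟨1, hone⟩
      ((zdGF3 𝔸 L β len ic).act (⟨1, hone⟩, ⟨U'', hmem⟩) u) := by
    intro j hj b hb
    obtain ⟨h1, h2, h3⟩ := h162 j hj b hb
    exact ⟨h1, h2, by rw [one_mul]; exact h3⟩
  obtain ⟨⟨-, h136g, -⟩, h139j, h139l⟩ :=
    P3 ⟨ic, hic⟩ ((L : ℝ) ^ 3 * α₀) (6 * d * (L : ℝ) ^ 2 * c.M * α₀) (B * ((L : ℝ) ^ 3 * α₀ + 6 * d * (L : ℝ) ^ 2 * c.M * α₀))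
      hα₀' hα₀c hα₁' hα₁c hα₂pos hα₂c h61 ⟨1, hone⟩ ((zdGF3 𝔸 L β len ic).act (⟨1, hone⟩, ⟨U'', hmem⟩) u) h33 trivial hPair h162'' hLan h137
  -- the three norm members of (1.136), with print's constant (`const_136`)
  have hconst : B * ((L : ℝ) ^ 3 * α₀ + 6 * d * (L : ℝ) ^ 2 * c.M * α₀) ≤ 7 * d * (L : ℝ) ^ 2 * B * c.M * α₀ :=
    const_136 hLpos hα hB0.le hLdM
  have h136₂ : B8ScaledSupNorm.msup L c.k η (-(2 : ℝ)) (fun j (t : Fin d × Fin d × Site d) => SideTouches (cubeFam false L c.a c.M c.ρ c.k j) t.2.2 t.2.1)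
      (fun t => B8Ineq132.covDerivFwd η (1 : Site d → Fin d → 𝔸ˣ) t.1
        (fun z => mlogCfg c.k η (cubeFam false L c.a c.M c.ρ c.k) (gaugeAct u.1⁻¹ U'') z t.2.1) t.2.2) ≤
      7 * d * (L : ℝ) ^ 2 * (5 * (d : ℝ) * L * inp.B₀) * c.M * α₀ := by
    have h := h136g
    simp only [zdGF3, mgauge_one_left] at h
    exact h.trans hconst
  have h136₃ : B8ScaledSupNorm.bondNorm L c.k η (-(3 : ℝ)) (cubeFam false L c.a c.M c.ρ c.k)
      (fun x μ => B8Eq143PlaqExpansion.pdiv η (1 : Site d → Fin d → 𝔸ˣ) (B8Eq146AExpansion.plaqCovDeriv η (1 : Site d → Fin d → 𝔸ˣ)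
        (mlogCfg c.k η (cubeFam false L c.a c.M c.ρ c.k) (gaugeAct u.1⁻¹ U''))) μ x) ≤
      7 * d * (L : ℝ) ^ 2 * (5 * (d : ℝ) * L * inp.B₀) * c.M * α₀ := by
    have h := h139j
    simp only [zdGF3, mgauge_one_left] at h
    exact h.trans hconst
  have h136₄ : B8ScaledSupNorm.bondNorm L c.k η (-(3 : ℝ)) (cubeFam false L c.a c.M c.ρ c.k)
      (fun x μ => B8Eq138LandauZd.covLap η (1 : Site d → Fin d → 𝔸ˣ)
        (fun z => mlogCfg c.k η (cubeFam false L c.a c.M c.ρ c.k) (gaugeAct u.1⁻¹ U'') z μ) x) ≤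
      7 * d * (L : ℝ) ^ 2 * (5 * (d : ℝ) * L * inp.B₀) * c.M * α₀ := by
    have h := h139l
    simp only [zdGF3, mgauge_one_left] at h
    exact h.trans hconst
  -- (1.135): `w = v⁻¹u` is unitary and `U₀^{w⁻¹} = U₁` on `□̃`
  have hΩ' : ∃ l, l ≤ c.k ∧ c.k ≤ l + 1 ∧ ∀ x, InBox (B8Ineq130.tlo L (tLo c.a c.ρ) c.k) (B8Ineq130.thi L (tHi c.a c.M c.ρ) c.k) x → x ∈ Ω l :=
    ⟨c.k - 1, Nat.sub_le _ _, by omega, fun x hx => c.tcube_sub hx⟩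
  have hvG : ∀ x, localGauge L (tLo c.a c.ρ) (tHi c.a c.M c.ρ) U₀ c.k (ctr c.a c.M) x ∈ unitaryUnits 𝔸 :=
    localGauge_mem L hL (avgClosed_unitaryUnits (𝔸 := 𝔸) d L) c.k U₀ hU₀ hα hα3 hα2 (tLo_le_tHi hM1)
      (pdevOn_lt_of_inAk hL1 hα hA hΩ') (ctr c.a c.M)
  have hw : ∀ x, ((localGauge L (tLo c.a c.ρ) (tHi c.a c.M c.ρ) U₀ c.k (ctr c.a c.M))⁻¹ * u.1) x ∈ unitaryUnits 𝔸 := fun x =>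
    (unitaryUnits 𝔸).mul_mem ((unitaryUnits 𝔸).inv_mem (hvG x)) (hu x)
  have h135 := agree135 (B8Ineq130.tlo L (tLo c.a c.ρ) c.k) (B8Ineq130.thi L (tHi c.a c.M c.ρ) c.k) U₀
    (localGauge L (tLo c.a c.ρ) (tHi c.a c.M c.ρ) U₀ c.k (ctr c.a c.M)) u.1
  -- the [3]-Prop.-4 window of the engine
  have h16C : 16 * (131072 * ((d : ℝ) + 1) ^ 2) * (B * ((L : ℝ) ^ 3 * α₀ + 6 * d * (L : ℝ) ^ 2 * c.M * α₀)) ≤ 1 := by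
    have e2 : 7 * d * (L : ℝ) ^ 2 * B * c.M * α₀ = B * (7 * d * (L : ℝ) ^ 2 * c.M * α₀) := by ring
    have e3 : B * (7 * d * (L : ℝ) ^ 2 * c.M * α₀) ≤ B * (1 / (16 * C * B)) := mul_le_mul_of_nonneg_left hsC hB0.le
    have e4 : B * (1 / (16 * C * B)) = 1 / (16 * C) := by field_simp
    have e5 : B * ((L : ℝ) ^ 3 * α₀ + 6 * d * (L : ℝ) ^ 2 * c.M * α₀) ≤ 1 / (16 * C) := by linarith [hconst, e3]
    calc 16 * (131072 * ((d : ℝ) + 1) ^ 2) * (B * ((L : ℝ) ^ 3 * α₀ + 6 * d * (L : ℝ) ^ 2 * c.M * α₀))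
        ≤ 16 * C * (1 / (16 * C)) := mul_le_mul_of_nonneg_left e5 (by positivity)
      _ = 1 := by field_simp
  exact gaugedBoundB8_of_clauses hd2 hL hB₀ hη c U₀ hU₀ hα hA hα3 hα2 hsmall h12 h16C hc3α u.1 hu huS h129 hLan' h162' hw h135
    h136₂ h136₃ h136₄

#print axioms gaugedBoundB8_cubeMember_of_printed

/-! ## §2 `B8.Prop6Printed` on the member `Node00.zdCub` and on the member of record, from the two printed statements -/

/-- **`B8.Prop6Printed d L B₁ c₁` ON `Node00.zdCub`, `B₁ = 5dL·inp.B₀`, FROM THEOREM 4 AND PROPOSITION 3 AS PRINTED ON THE CUBE SUB-FAMILY**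
(Proposition 6, p. 99, for every ambient family `f j : ZdIdx d L` and every cube `c : CubeB8` in it; socket-free): `gaugedBoundB8_cubeMember_of_printed`
read through `Node00.prop6Printed_zdCub_iff`. [cite: Balaban1985RegularSpaces, Prop. 6 p.99, Thm 4 p.88, Prop. 3 p.87] -/
theorem prop6Printed_zdCub_of_printed (hd2 : 2 ≤ d) {L : ℕ} (hL : 2 ≤ L) (inp : B8.B9Inputs) {B₀β C₂ : ℝ} (hC₂ : 0 ≤ C₂)
    (β : ℝ) (len : Site d → ℝ)
    (H4 : B8.Thm4Printed (5 * (d : ℝ) * L * inp.B₀)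
      (fun i : {i : ZdIdx d L // ∃ (a : Site d) (M ρ : ℕ), L ≤ ρ ∧ ρ ≤ M ∧ 11 * d < M ∧ L ≤ d * M ∧
        i.Ω = cubeFam false L a M ρ i.k ∧ i.Λs = cubeLamS L a M ρ i.k ∧
        i.Λb = cubeLamB L a M ρ i.k} => (zdGF3 𝔸 L β len i.1).toGFData))
    (H3 : B8.Prop3Printed d (L : ℝ) C₂ inp B₀β
      (fun i : {i : ZdIdx d L // ∃ (a : Site d) (M ρ : ℕ), L ≤ ρ ∧ ρ ≤ M ∧ 11 * d < M ∧ L ≤ d * M ∧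
        i.Ω = cubeFam false L a M ρ i.k ∧ i.Λs = cubeLamS L a M ρ i.k ∧
        i.Λb = cubeLamB L a M ρ i.k} => (zdGF3 𝔸 L β len i.1).toGFData2)) :
    ∃ c₁ : ℝ, 0 < c₁ ∧ ∀ {ι : Type} (f : ι → ZdIdx d L),
      B8.Prop6Printed d (L : ℝ) (5 * (d : ℝ) * L * inp.B₀) c₁ (fun j => zdCub 𝔸 L (f j)) := by
  obtain ⟨c₁, hc₁, G⟩ := gaugedBoundB8_cubeMember_of_printed (𝔸 := 𝔸) hd2 hL inp hC₂ β len H4 H3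
  refine ⟨c₁, hc₁, fun f => ?_⟩
  rw [prop6Printed_zdCub_iff]
  intro j α₀ hα U₀ hInA c hs
  exact G (f j).η (f j).hη c U₀.1 U₀.2 α₀ hα hInA hs

/-- **`B8.Prop6Printed` ON NODE 00's MEMBER OF RECORD `Node00.cubB8OfRecord θ`** (the `p6` letter of the record knits at the located layer
`ResidB8.withCub`), `B₁ := 5·θ.D·θ.L·inp.B₀`, FROM THEOREM 4 AND PROPOSITION 3 AS PRINTED on the cube sub-family of `ZdIdx θ.D θ.L`
(`prop6Printed_zdCub_of_printed` at `f := Subtype.val`; socket-free). [cite: Balaban1985RegularSpaces, Prop. 6 p.99, Thm 4 p.88, Prop. 3 p.87] -/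
theorem prop6Printed_cubB8OfRecord_of_printed (θ : Node00.Stage3Params) (hD : 2 ≤ θ.D) (inp : B8.B9Inputs) {B₀β C₂ : ℝ} (hC₂ : 0 ≤ C₂)
    (β : ℝ) (len : Site θ.D → ℝ)
    (H4 : B8.Thm4Printed (5 * (θ.D : ℝ) * θ.L * inp.B₀)
      (fun i : {i : ZdIdx θ.D θ.L // ∃ (a : Site θ.D) (M ρ : ℕ), θ.L ≤ ρ ∧ ρ ≤ M ∧ 11 * θ.D < M ∧ θ.L ≤ θ.D * M ∧
        i.Ω = cubeFam false θ.L a M ρ i.k ∧ i.Λs = cubeLamS θ.L a M ρ i.k ∧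
        i.Λb = cubeLamB θ.L a M ρ i.k} => (zdGF3 θ.𝔸 θ.L β len i.1).toGFData))
    (H3 : B8.Prop3Printed θ.D (θ.L : ℝ) C₂ inp B₀β
      (fun i : {i : ZdIdx θ.D θ.L // ∃ (a : Site θ.D) (M ρ : ℕ), θ.L ≤ ρ ∧ ρ ≤ M ∧ 11 * θ.D < M ∧ θ.L ≤ θ.D * M ∧
        i.Ω = cubeFam false θ.L a M ρ i.k ∧ i.Λs = cubeLamS θ.L a M ρ i.k ∧
        i.Λb = cubeLamB θ.L a M ρ i.k} => (zdGF3 θ.𝔸 θ.L β len i.1).toGFData2)) :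
    ∃ c₁ : ℝ, 0 < c₁ ∧ B8.Prop6Printed θ.D (θ.L : ℝ) (5 * (θ.D : ℝ) * θ.L * inp.B₀) c₁ (Node00.cubB8OfRecord θ) := by
  obtain ⟨c₁, hc₁, G⟩ := prop6Printed_zdCub_of_printed (𝔸 := θ.𝔸) hD θ.two_le_L inp hC₂ β len H4 H3
  exact ⟨c₁, hc₁, G (fun i : Node00.IdxB8 θ => i.1)⟩

/-! ## §3 The same from Theorem 4 and Proposition 3 hypothesised on the WHOLE index `ZdIdx d L` (the H4-currency knit's binders) -/

/-- **(1.135)–(1.138) AS `GaugedBoundB8` AT EVERY CUBE, FROM THE KNIT's BINDERS** `H4 : B8.Thm4Printed (5dL·inp.B₀) (fun i : ZdIdx d L => (zdGF3 𝔸 L β len i).toGFData)`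
and `p3 : B8.Prop3Printed d L C₂ inp B₀β (fun i : ZdIdx d L => (zdGF3 𝔸 L β len i).toGFData2)` — the binders of
`B8LeafKnitZd3OfThm4.b8LeafRS_zd3_univ_of_thm4` verbatim; restriction of the family index to the cube sub-family is pure logic.
[cite: Balaban1985RegularSpaces, Prop. 6 (1.135)–(1.138) p.99, Thm 4 p.88, Prop. 3 p.87] -/
theorem gaugedBoundB8_cubeMember_of_printedAll (hd2 : 2 ≤ d) {L : ℕ} (hL : 2 ≤ L) (inp : B8.B9Inputs) {B₀β C₂ : ℝ} (hC₂ : 0 ≤ C₂)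
    (β : ℝ) (len : Site d → ℝ)
    (H4 : B8.Thm4Printed (5 * (d : ℝ) * L * inp.B₀) (fun i : ZdIdx d L => (zdGF3 𝔸 L β len i).toGFData))
    (H3 : B8.Prop3Printed d (L : ℝ) C₂ inp B₀β (fun i : ZdIdx d L => (zdGF3 𝔸 L β len i).toGFData2)) :
    ∃ c₁ : ℝ, 0 < c₁ ∧ ∀ (η : ℝ), 0 < η → ∀ {K : ℕ} {Ω : ℕ → Set (Site d)} (c : CubeB8 d L K Ω),
      ∀ (U₀ : Site d → Fin d → 𝔸ˣ), (∀ x κ, U₀ x κ ∈ unitaryUnits 𝔸) → ∀ (α₀ : ℝ), 0 < α₀ → InAk L K η α₀ Ω U₀ →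
      7 * d * (L : ℝ) ^ 2 * c.M * α₀ ≤ c₁ →
      GaugedBoundB8 L η U₀ c (7 * d * (L : ℝ) ^ 2 * (5 * (d : ℝ) * L * inp.B₀) * c.M * α₀) := by
  obtain ⟨c₄, hc₄, T4⟩ := H4
  obtain ⟨c₃, hc₃, P3⟩ := H3
  exact gaugedBoundB8_cubeMember_of_printed (𝔸 := 𝔸) hd2 hL inp hC₂ β len ⟨c₄, hc₄, fun i => T4 i.1⟩ ⟨c₃, hc₃, fun i => P3 i.1⟩

/-- **`B8.Prop6Printed d L (5dL·inp.B₀) c₁` ON `Node00.zdCub` FROM THE KNIT's BINDERS `H4` and `p3`** (whole index `ZdIdx d L`): in the currency of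
`B8LeafKnitZd3OfThm4.b8LeafRS_zd3_univ_of_thm4` the `p6` binder (at `cub := fun j => zdCub 𝔸 L (f j)`, `B₁ := 5dL·inp.B₀`) is a consequence of the
`H4` and `p3` binders the knit already carries. [cite: Balaban1985RegularSpaces, Prop. 6 p.99, Thm 4 p.88, Prop. 3 p.87] -/
theorem prop6Printed_zdCub_of_printedAll (hd2 : 2 ≤ d) {L : ℕ} (hL : 2 ≤ L) (inp : B8.B9Inputs) {B₀β C₂ : ℝ} (hC₂ : 0 ≤ C₂)
    (β : ℝ) (len : Site d → ℝ)
    (H4 : B8.Thm4Printed (5 * (d : ℝ) * L * inp.B₀) (fun i : ZdIdx d L => (zdGF3 𝔸 L β len i).toGFData))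
    (H3 : B8.Prop3Printed d (L : ℝ) C₂ inp B₀β (fun i : ZdIdx d L => (zdGF3 𝔸 L β len i).toGFData2)) :
    ∃ c₁ : ℝ, 0 < c₁ ∧ ∀ {ι : Type} (f : ι → ZdIdx d L),
      B8.Prop6Printed d (L : ℝ) (5 * (d : ℝ) * L * inp.B₀) c₁ (fun j => zdCub 𝔸 L (f j)) := by
  obtain ⟨c₄, hc₄, T4⟩ := H4
  obtain ⟨c₃, hc₃, P3⟩ := H3
  exact prop6Printed_zdCub_of_printed (𝔸 := 𝔸) hd2 hL inp hC₂ β len ⟨c₄, hc₄, fun i => T4 i.1⟩ ⟨c₃, hc₃, fun i => P3 i.1⟩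

/-- **`B8.Prop6Printed` ON NODE 00's MEMBER OF RECORD FROM THE KNIT's BINDERS `H4` and `p3`** (whole index `ZdIdx θ.D θ.L`).
[cite: Balaban1985RegularSpaces, Prop. 6 p.99, Thm 4 p.88, Prop. 3 p.87] -/
theorem prop6Printed_cubB8OfRecord_of_printedAll (θ : Node00.Stage3Params) (hD : 2 ≤ θ.D) (inp : B8.B9Inputs) {B₀β C₂ : ℝ} (hC₂ : 0 ≤ C₂)
    (β : ℝ) (len : Site θ.D → ℝ)
    (H4 : B8.Thm4Printed (5 * (θ.D : ℝ) * θ.L * inp.B₀) (fun i : ZdIdx θ.D θ.L => (zdGF3 θ.𝔸 θ.L β len i).toGFData))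
    (H3 : B8.Prop3Printed θ.D (θ.L : ℝ) C₂ inp B₀β (fun i : ZdIdx θ.D θ.L => (zdGF3 θ.𝔸 θ.L β len i).toGFData2)) :
    ∃ c₁ : ℝ, 0 < c₁ ∧ B8.Prop6Printed θ.D (θ.L : ℝ) (5 * (θ.D : ℝ) * θ.L * inp.B₀) c₁ (Node00.cubB8OfRecord θ) := by
  obtain ⟨c₄, hc₄, T4⟩ := H4
  obtain ⟨c₃, hc₃, P3⟩ := H3
  exact prop6Printed_cubB8OfRecord_of_printed θ hD inp hC₂ β len ⟨c₄, hc₄, fun i => T4 i.1⟩ ⟨c₃, hc₃, fun i => P3 i.1⟩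

#print axioms prop6Printed_zdCub_of_printed
#print axioms prop6Printed_cubB8OfRecord_of_printed
#print axioms gaugedBoundB8_cubeMember_of_printedAll
#print axioms prop6Printed_zdCub_of_printedAll
#print axioms prop6Printed_cubB8OfRecord_of_printedAll

end Literature.MathematicalPhysics.QuantumFieldTheory.Balaban1983to89.B8Prop6CubeMemberOfPrinted

end
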